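import Summits.BirchSwinnertonDyer.BirchSwinnertonDyer.Theorems.ResidualThetaTransportAtTwoResidualSignedLambdaLowerCMAtTwoDeepHalfAtTwoLevelwise
import Summits.BirchSwinnertonDyer.BirchSwinnertonDyer.Theorems.ResidualThetaTransportAtTwoResidualSignedLambdaLowerCMAtTwoDeepHalfValueTransfer
import Summits.BirchSwinnertonDyer.BirchSwinnertonDyer.Theorems.ResidualThetaTransportAtTwoResidualSignedLambdaLowerCMAtTwoLayerPairingOfFunMackeyDual
import Summits.BirchSwinnertonDyer.BirchSwinnertonDyer.Theorems.ResidualThetaTransportAtTwoResidualSignedLambdaLowerCMAtTwoCofreeAdmissible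
import Literature.NumberTheory.GaloisRepresentations.ContinuousShapiroLiftFunctor
import Summits.BirchSwinnertonDyer.BirchSwinnertonDyer.Theorems.ResidualThetaTransportAtTwoResidualSignedLambdaLowerCMAtTwoLayerLocVanishing
import HarnessLib

/-!
# STRICTNESS AT `S₀` IN SHAPIRO CURRENCY IS `[p]_*`- AND `Cor`-STABLE (the `hSk` / `hSn` of the strict part of the deep-half solution
# sets of item 6 `stub_deepHalfAtTwoStrict`)

Route `ResidualThetaTransportAtTwo` (RTT), crux RSL_g `ResidualSignedLambdaLowerCMAtTwo` (stmt-BirchSwinnertonDyer-22608); seat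
`prover-bsd-wall-tp2-p2x` g18 (`--supports 22608 --as helper`, closes nothing). THEOREMS ONLY (no definition, no named fact, no instance,
no `sorry`). STUB-PLAN `stub_cmLambdaLower` rev 18/19 §3 items 6/7: the levelwise solution sets of the deep half are cut out of
`H¹(Γ_n, A_ρ[p^k])` by (adm) admissibility (`…CofreeAdmissible`: `admissible_cofreeTorsionPow`, `admissible_layerCores`, `admissible_finite`),
(val) the value condition at `v ∣ p` (`…DeepHalfValueTransfer` §3) and (strict) **`loc_w (Sh_n c) = 0` for `w ∈ S₀`** — the output currency of
the levelwise Poitou–Tate calls `…DeepHalfAtTwoLevelwise` / `…DeepHalfAwayTwoLevelwise`. This file supplies the `[p]_*`- and `Cor`-stability of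
(strict), i.e. the strict part of the hypotheses `hSk` / `hSn` of `ThetaTransport.exists_iwasawaH1_of_levelwise_from`:

* §1 `localization_inr_cohomologyMap_eq_zero` (generic discrete `Γ_ℚ`-modules): `loc_w b = 0 ⟹ loc_w (H¹(f) b) = 0` for a morphism `f`.
* §2 `strictAt_cofreeTorsionPow` — `loc_w (Sh_n c) = 0 ⟹ loc_w (Sh_n ([p]_* c)) = 0` (`shapiroLift_cohomologyMap`: `Sh ∘ [p]_* = H¹(coindFinMap [p]) ∘ Sh`).
* §3 `strictAt_layerCores` — `loc_w (Sh_{n+1} c) = 0 ⟹ loc_w (Sh_n (cor c)) = 0` (`cohomologyMap_coindFinSum_shapiroLift`: `Sh_n ∘ cor = H¹(Σ_fibres) ∘ Sh_{n+1}`;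
  any coset representatives at the two levels).
* §4 the ASSEMBLY of item 6 modulo the levelwise orthogonality (`exists_iwasawaH1_locd₂_eq_strict_of_levelwise_orthogonal`, GV-dialect strictness
  on the output via `ShapiroTransport.resOfLe_decomp_conjH1_eq_zero_of_localization_shapiroLift_eq_zero`; and `…_layerLocOf_…` with the
  strictness ALSO as `layerLocOf … w n (red x) = 0`, the AwayTwo pins' currency, via `CofreeSelmerTransfer.layerLocOf_eq_zero_of_resOfLe_decomp_eq_zero`).

References: [NeukirchSchmidtWingberg2008] I §5 (1.5.3)(iv), I §6 Prop. (1.6.4)–(1.6.5); [SerreGaloisCohomology1997] I §2.4–2.5; [Kato2004Asterisque]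
§12.2 (p. 220), §13.8 (p. 228). BSD is not proved by any of this; RSL_g (22608) and the K3 crux (20308) stay OPEN.
-/

set_option autoImplicit false
-- the Theorems namespace of this sub repeats the summit name by design (D-0017 nested layout)
set_option linter.dupNamespace false

noncomputable section

open scoped Classical

namespace Summit.BirchSwinnertonDyer.BirchSwinnertonDyer.Theorems

namespace ThetaTransport.DeepHalfAssembly

open CategoryTheory Field NumberField IsDedekindDomain WeierstrassCurve
  Literature.NumberTheory.EllipticCurves Literature.NumberTheory.EllipticCurves.GreenbergSelmer
  Literature.NumberTheory.EllipticCurves.CyclotomicLayer Literature.NumberTheory.EllipticCurves.Kobayashi2003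
  Literature.NumberTheory.EllipticCurves.Sprung2012
  Literature.NumberTheory.GaloisRepresentations Literature.NumberTheory.GaloisRepresentations.DiscreteGaloisModule
  Literature.NumberTheory.GaloisCohomology Literature.NumberTheory.EllipticCurves.Kato2004 ZpExtension

/-! ## §1 Localisation at a finite place commutes with `H¹` of a morphism: the zero form -/

section Generic

variable {M M' : Type} [AddCommGroup M] [TopologicalSpace M] [DiscreteTopology M]
  [AddCommGroup M'] [TopologicalSpace M'] [DiscreteTopology M']
  (ρ : DiscreteGaloisModule ℚ M) (ρ' : DiscreteGaloisModule ℚ M')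

/-- **`loc_w b = 0 ⟹ loc_w (H¹(f) b) = 0`** for a morphism `f : M' → M` of discrete `Γ_ℚ`-modules and a finite place `w`: on cocycles, if
`g ∘ θ_w` is the coboundary of `a` then `f ∘ g ∘ θ_w` is the coboundary of `f a`. [cite: SerreGaloisCohomology1997, I §2.4]
[cite: NeukirchSchmidtWingberg2008, I §5 (1.5.2)] -/
theorem localization_inr_cohomologyMap_eq_zero (f : ρ'.toTopRep ⟶ ρ.toTopRep) (w : HeightOneSpectrum (𝓞 ℚ))
    (b : galoisCohomology ρ' 1) (hb : galoisCohomology.localization ρ' (Sum.inr w) 1 b = 0) :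
    galoisCohomology.localization ρ (Sum.inr w) 1 (cohomologyMap f 1 b) = 0 := by
  obtain ⟨g, rfl⟩ := oneCocycleClass_surjective _ b
  rw [LayerPairingMackeyDual.localization_eq_map, map_oneCocycleClass] at hb
  obtain ⟨a, ha⟩ := (oneCocycleClass_eq_zero_iff _ _).mp hb
  rw [cohomologyMap_oneCocycleClass, LayerPairingMackeyDual.localization_eq_map, map_oneCocycleClass]
  refine (oneCocycleClass_eq_zero_iff _ _).mpr ⟨f.hom a, fun τ => ?_⟩
  have h := ha τ
  change f.hom (g.1 (resGalOfEmb (closureEmb (K := ℚ) (w.adicCompletion ℚ)) τ)) =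
    ρ.toTopRep.ρ (resGalOfEmb (closureEmb (K := ℚ) (w.adicCompletion ℚ)) τ) (f.hom a) - f.hom a
  change g.1 (resGalOfEmb (closureEmb (K := ℚ) (w.adicCompletion ℚ)) τ) =
    ρ'.toTopRep.ρ (resGalOfEmb (closureEmb (K := ℚ) (w.adicCompletion ℚ)) τ) a - a at h
  rw [h, map_sub]
  congr 1
  exact DFunLike.congr_fun (f.hom.isIntertwining' (resGalOfEmb (closureEmb (K := ℚ) (w.adicCompletion ℚ)) τ)) a

end Generic

/-! ## §2–§3 Strictness at a finite place `w` in Shapiro currency: `[p]_*`- and `Cor`-stability -/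

section Rho

variable {p : ℕ} [Fact p.Prime] (S : Set (PadicAlgCl p)) {d : ℕ} (ρ : FramedGaloisRep ℚ ↥(padicCoeffIntegers S) d)
  (κ : ZpExtension ℚ p) (n : ℕ) [Fintype (absoluteGaloisGroup ℚ ⧸ κ.layerSubgroup n)]
  {s : absoluteGaloisGroup ℚ ⧸ κ.layerSubgroup n → absoluteGaloisGroup ℚ}
  (hs : ∀ x : absoluteGaloisGroup ℚ ⧸ κ.layerSubgroup n, (s x : absoluteGaloisGroup ℚ ⧸ κ.layerSubgroup n) = x)
  (hs1 : s ((1 : absoluteGaloisGroup ℚ) : absoluteGaloisGroup ℚ ⧸ κ.layerSubgroup n) = 1)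
  (w : HeightOneSpectrum (𝓞 ℚ))

/-- **`[p]_*`-stability of strictness at `w`**: if `loc_w (Sh_n c) = 0` for `c ∈ H¹(Γ_n, A_ρ[p^{k+1}])` then `loc_w (Sh_n ([p]_* c)) = 0`
(`Sh ∘ [p]_* = H¹(coindFinMap [p]) ∘ Sh`, `shapiroLift_cohomologyMap`, and §1). [cite: NeukirchSchmidtWingberg2008, I §6 Prop. (1.6.4)]
[cite: Kato2004Asterisque, §13.8 (p. 228)] -/
theorem strictAt_cofreeTorsionPow (k : ℕ) (c : H1 (cofreeTorsionGaloisModule S ρ ((p ^ (k + 1) : ℕ) : ℤ)) (κ.layerSubgroup n))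
    (hc : galoisCohomology.localization
        ((cofreeTorsionGaloisModule S ρ ((p ^ (k + 1) : ℕ) : ℤ)).coind (κ.layerSubgroup n) (κ.isOpen_layerSubgroup n)) (Sum.inr w) 1
        (shapiroLift (cofreeTorsionGaloisModule S ρ ((p ^ (k + 1) : ℕ) : ℤ)).toTopRep (κ.layerSubgroup n) (κ.isOpen_layerSubgroup n)
          hs hs1 c) = 0) :
    galoisCohomology.localization
        ((cofreeTorsionGaloisModule S ρ ((p ^ k : ℕ) : ℤ)).coind (κ.layerSubgroup n) (κ.isOpen_layerSubgroup n)) (Sum.inr w) 1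
        (shapiroLift (cofreeTorsionGaloisModule S ρ ((p ^ k : ℕ) : ℤ)).toTopRep (κ.layerSubgroup n) (κ.isOpen_layerSubgroup n)
          hs hs1 (cohomologyMap (subgroupRepMap (cofreeTorsionPow S ρ k) (κ.layerSubgroup n)) 1 c)) = 0 := by
  rw [shapiroLift_cohomologyMap]
  exact localization_inr_cohomologyMap_eq_zero
    ((cofreeTorsionGaloisModule S ρ ((p ^ k : ℕ) : ℤ)).coind (κ.layerSubgroup n) (κ.isOpen_layerSubgroup n))
    ((cofreeTorsionGaloisModule S ρ ((p ^ (k + 1) : ℕ) : ℤ)).coind (κ.layerSubgroup n) (κ.isOpen_layerSubgroup n))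
    (coindFinMap (cofreeTorsionPow S ρ k) (κ.layerSubgroup n)) w _ hc

variable [Fintype (absoluteGaloisGroup ℚ ⧸ κ.layerSubgroup (n + 1))]
  {s' : absoluteGaloisGroup ℚ ⧸ κ.layerSubgroup (n + 1) → absoluteGaloisGroup ℚ}
  (hs' : ∀ x : absoluteGaloisGroup ℚ ⧸ κ.layerSubgroup (n + 1), (s' x : absoluteGaloisGroup ℚ ⧸ κ.layerSubgroup (n + 1)) = x)
  (hs'1 : s' ((1 : absoluteGaloisGroup ℚ) : absoluteGaloisGroup ℚ ⧸ κ.layerSubgroup (n + 1)) = 1)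

/-- **`Cor`-stability of strictness at `w`**: if `loc_w (Sh_{n+1} c) = 0` for `c ∈ H¹(Γ_{n+1}, A_ρ[N])` then `loc_w (Sh_n (cor c)) = 0`
(Shapiro carries Kato's trace to `H¹` of the fibre-sum morphism `Maps(Γ_ℚ ⧸ Γ_{n+1}, ·) → Maps(Γ_ℚ ⧸ Γ_n, ·)`,
`cohomologyMap_coindFinSum_shapiroLift`, and §1; any coset representatives at the two levels). [cite: NeukirchSchmidtWingberg2008, I §5 Prop. (1.5.3)(iv)]
[cite: Kato2004Asterisque, §12.2 (p. 220)] -/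
theorem strictAt_layerCores (N : ℤ) (c : H1 (cofreeTorsionGaloisModule S ρ N) (κ.layerSubgroup (n + 1)))
    (hc : galoisCohomology.localization
        ((cofreeTorsionGaloisModule S ρ N).coind (κ.layerSubgroup (n + 1)) (κ.isOpen_layerSubgroup (n + 1))) (Sum.inr w) 1
        (shapiroLift (cofreeTorsionGaloisModule S ρ N).toTopRep (κ.layerSubgroup (n + 1)) (κ.isOpen_layerSubgroup (n + 1))
          hs' hs'1 c) = 0) :
    galoisCohomology.localization
        ((cofreeTorsionGaloisModule S ρ N).coind (κ.layerSubgroup n) (κ.isOpen_layerSubgroup n)) (Sum.inr w) 1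
        (shapiroLift (cofreeTorsionGaloisModule S ρ N).toTopRep (κ.layerSubgroup n) (κ.isOpen_layerSubgroup n)
          hs hs1 (layerCores (cofreeTorsionGaloisModule S ρ N) κ n c)) = 0 := by
  haveI : CompactSpace (absoluteGaloisGroup ℚ) := absoluteGaloisGroup_compactSpace ℚ
  haveI : (κ.layerSubgroup (n + 1)).FiniteIndex := finiteIndex_of_isOpen_of_compactSpace _ (κ.isOpen_layerSubgroup (n + 1))
  letI : Fintype (κ.layerSubgroup n ⧸ (κ.layerSubgroup (n + 1)).subgroupOf (κ.layerSubgroup n)) := Fintype.ofFinite _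
  have hcores : layerCores (cofreeTorsionGaloisModule S ρ N) κ n c =
      coresLe (cofreeTorsionGaloisModule S ρ N).toTopRep (κ.layerSubgroup_antitone (Nat.le_succ n))
        (κ.isOpen_layerSubgroup (n + 1)) c := rfl
  rw [hcores, ← cohomologyMap_coindFinSum_shapiroLift (cofreeTorsionGaloisModule S ρ N).toTopRep
    (κ.layerSubgroup_antitone (Nat.le_succ n)) (κ.isOpen_layerSubgroup n) (κ.isOpen_layerSubgroup (n + 1)) hs hs1 hs' hs'1 c]
  exact localization_inr_cohomologyMap_eq_zero
    ((cofreeTorsionGaloisModule S ρ N).coind (κ.layerSubgroup n) (κ.isOpen_layerSubgroup n))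
    ((cofreeTorsionGaloisModule S ρ N).coind (κ.layerSubgroup (n + 1)) (κ.isOpen_layerSubgroup (n + 1)))
    (coindFinSum (cofreeTorsionGaloisModule S ρ N).toTopRep (κ.layerSubgroup_antitone (Nat.le_succ n))) w _ hc

end Rho


/-! ## §4 ASSEMBLY of item 6 (S4₂) modulo the levelwise orthogonality: `∃ x ∈ 𝐇¹_Γ(T_ρ)` with `locd₂ x = z`, admissible and
STRICT at `S₀` at every level `n ≥ N₀` and every `k` -/

section Assembly

open ThetaTransport.DeepHalfTransfer ThetaTransport.DeepHalfLevelwise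

variable {p : ℕ} [Fact p.Prime] (S : Set (PadicAlgCl p)) {d : ℕ} (ρ : FramedGaloisRep ℚ ↥(padicCoeffIntegers S) d)
  (W : WeierstrassCurve ℚ) [W.IsElliptic] {r : ℕ}
  (ePk : ∀ k : ℕ, ↥(AddSubgroup.torsionBy (Cofree ρ ↥(padicCoeffField S)) ((p ^ k : ℕ) : ℤ)) →
    ↥(AddSubgroup.torsionBy (Cofree ρ ↥(padicCoeffField S)) ((p ^ k : ℕ) : ℤ)) → AlgebraicClosure ℚ)
  (hμPk : ∀ k a b, ePk k a b ^ (p ^ k) = 1)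
  (hadd₁Pk : ∀ k a₁ a₂ b, ePk k (a₁ + a₂) b = ePk k a₁ b * ePk k a₂ b)
  (hadd₂Pk : ∀ k a b₁ b₂, ePk k a (b₁ + b₂) = ePk k a b₁ * ePk k a b₂)
  (hgalPk : ∀ k (σ : absoluteGaloisGroup ℚ) (a b : ↥(AddSubgroup.torsionBy (Cofree ρ ↥(padicCoeffField S)) ((p ^ k : ℕ) : ℤ))),
    σ • ePk k a b = ePk k (cofreeTorsionGaloisModule S ρ _ σ a) (cofreeTorsionGaloisModule S ρ _ σ b))
  (htower : ∀ k (a b : ↥(AddSubgroup.torsionBy (Cofree ρ ↥(padicCoeffField S)) ((p ^ (k + 1) : ℕ) : ℤ))),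
    ePk k ((cofreeTorsionPow S ρ k).hom a) ((cofreeTorsionPow S ρ k).hom b) = ePk (k + 1) a b ^ p)
  (hnondeg : ∀ k T, (∀ a, ePk k a T = 1) → T = 0)
  (Θ : Cofree ρ ↥(padicCoeffField S) ≃+ (Fin r → ↥(W.geomPrimaryTorsion p))) (κ : ZpExtension ℚ p)
  (v : HeightOneSpectrum (𝓞 ℚ))
  (hΘ : ∀ (δ : absoluteGaloisGroup (v.adicCompletion ℚ)) (m : Cofree ρ ↥(padicCoeffField S)) (i : Fin r),
    Θ (resGalOfEmb (closureEmb (K := ℚ) (v.adicCompletion ℚ)) δ • m) i =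
      resGalOfEmb (closureEmb (K := ℚ) (v.adicCompletion ℚ)) δ • Θ m i)
  (hκ : κ.IsCyclotomic) (hv : (p : 𝓞 ℚ) ∈ v.asIdeal)
  (S₀ : Finset (HeightOneSpectrum (𝓞 ℚ))) (hS₀ : ∀ w ∈ S₀, (p : 𝓞 ℚ) ∉ w.asIdeal)
  (hρ : ∀ w : HeightOneSpectrum (𝓞 ℚ), w ∉ S₀ → (p : 𝓞 ℚ) ∉ w.asIdeal → ρ.IsUnramifiedAt w)
  {γ : absoluteGaloisGroup ℚ} (I : IwasawaH1DataCoeff (FramedGaloisRep.toGaloisRep ρ) p κ γ)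
  (pair : ∀ m : ℕ, H1 (FramedGaloisRep.toGaloisRep ρ) (κ.layerSubgroup m) →+
    ((Fin r → localLayerPointsOfEmb κ (closureEmb (K := ℚ) (v.adicCompletion ℚ)) W m) →+ ℤ_[p]))
  (hpair : ∀ (m k : ℕ) (x : H1 (FramedGaloisRep.toGaloisRep ρ) (κ.layerSubgroup m))
    (Q : Fin r → localLayerPointsOfEmb κ (closureEmb (K := ℚ) (v.adicCompletion ℚ)) W m),
    PadicInt.toZModPow k (pair m x Q) = rhoLayerPairingPk S ρ W ePk hμPk hadd₁Pk hadd₂Pk hgalPk Θ κ v hΘ m k x Q)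
  {locd₂ : I.H →+ ((Fin r → localTowerPointsOfEmb κ (closureEmb (K := ℚ) (v.adicCompletion ℚ)) W) →+ ℤ_[p])}
  (hlocd : ∀ (m : ℕ) (x : I.H) (Q : Fin r → localPoints W (v.adicCompletion ℚ))
    (hQ : ∀ i, Q i ∈ localLayerPointsOfEmb κ (closureEmb (K := ℚ) (v.adicCompletion ℚ)) W m),
    locd₂ x (fun i => ⟨Q i, localLayerPointsOfEmb_le_localTowerPointsOfEmb κ _ W m (hQ i)⟩) = pair m (I.proj m x) (fun i => ⟨Q i, hQ i⟩))

include htower hnondeg hκ hv hS₀ hρ hpair hlocd in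
/-- **Item 6 (S4₂) ASSEMBLED modulo the levelwise orthogonality.** For the CYCLOTOMIC `κ`, compact `𝒪`, the v2c pins
(`pair`/`hpair`, `locd₂`/`hlocd`), a self-dual TOWER `ePk` (compatible `htower`, non-degenerate at every level `hnondeg`), `Θ` equivariant at
`v ∣ p`, `S₀ ∌ p` outside which (and off `p`) `ρ` is unramified, a functional `z` on tower tuples and a level floor `N₀`: if for every
`n ≥ N₀`, every `k` and every choice of coset representatives the LEVELWISE ORTHOGONALITY `hT` holds (the output of GLUE-67 = (T)_ρ ∘
item 6's Λ-adic hypothesis ∘ readback), then there is `x ∈ 𝐇¹_Γ(T_ρ)` (`I.H`) with `locd₂ x = z` whose reductions `red_{p^k}(proj_n x)`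
(`n ≥ N₀`, all `k`) are ADMISSIBLE outside `S₀ ∪ {w ∋ p}` and STRICT at `S₀`: every conjugate dies on `Γ_n ∩ D_w`, `w ∈ S₀` (Greenberg–Vatsal
dialect) — the input of the `S₀`-side pin transfer `locd_S x = 0`. Solution sets `Sol n k` = admissible ∩ strict-at-`S₀` (Shapiro currency) ∩
value condition; `hfin` `…CofreeAdmissible`, `hne` = the levelwise Poitou–Tate call `…DeepHalfAtTwoLevelwise` (`_top`), `hSk`/`hSn` =
`admissible_cofreeTorsionPow`/`admissible_layerCores` + §2/§3 + `DeepHalfTransfer.valueCond_*`, limit + transfer =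
`DeepHalfTransfer.exists_iwasawaH1_locd₂_eq_of_levelwise_from`, GV reading = `ShapiroTransport.resOfLe_decomp_conjH1_eq_zero_of_localization_shapiroLift_eq_zero`.
CONDITIONAL on `hT`; nothing about any count; BSD is not proved by any of this. [cite: Kato2004Asterisque, §12.2 (p. 220), §13.8 (p. 228)]
[cite: Rubin2000, App. B Prop. B.2.3, §B.3] [cite: MilneADT2006, Ch. I, Thm. 4.10(b)] [cite: Kobayashi2003, (7.17)–(7.21), Thm. 7.3] -/
theorem exists_iwasawaH1_locd₂_eq_strict_of_levelwise_orthogonal [CompactSpace ↥(padicCoeffIntegers S)] (N₀ : ℕ)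
    (z : (Fin r → localTowerPointsOfEmb κ (closureEmb (K := ℚ) (v.adicCompletion ℚ)) W) →+ ℤ_[p])
    (hT : ∀ n, N₀ ≤ n → ∀ (k : ℕ) [Fintype (absoluteGaloisGroup ℚ ⧸ κ.layerSubgroup n)]
      {s : absoluteGaloisGroup ℚ ⧸ κ.layerSubgroup n → absoluteGaloisGroup ℚ}
      (hs : ∀ x : absoluteGaloisGroup ℚ ⧸ κ.layerSubgroup n, (s x : absoluteGaloisGroup ℚ ⧸ κ.layerSubgroup n) = x)
      (hs1 : s ((1 : absoluteGaloisGroup ℚ) : absoluteGaloisGroup ℚ ⧸ κ.layerSubgroup n) = 1)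
      (b : H1 (cofreeTorsionGaloisModule S ρ ((p ^ k : ℕ) : ℤ)) (κ.layerSubgroup n))
      (Q₀ : Fin r → localLayerPointsOfEmb κ (closureEmb (K := ℚ) (v.adicCompletion ℚ)) W n),
      (∀ w : HeightOneSpectrum (𝓞 ℚ), w ∉ S₀ → (p : 𝓞 ℚ) ∉ w.asIdeal →
        galoisCohomology.localization
            ((cofreeTorsionGaloisModule S ρ ((p ^ k : ℕ) : ℤ)).coind (κ.layerSubgroup n) (κ.isOpen_layerSubgroup n)) (Sum.inr w) 1
            (shapiroLift (cofreeTorsionGaloisModule S ρ ((p ^ k : ℕ) : ℤ)).toTopRep (κ.layerSubgroup n) (κ.isOpen_layerSubgroup n)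
              hs hs1 b) ∈
          unramifiedSubgroup (GaloisRep.toLocal w
            ((cofreeTorsionGaloisModule S ρ ((p ^ k : ℕ) : ℤ)).coind (κ.layerSubgroup n) (κ.isOpen_layerSubgroup n))) 1) →
      (∀ w : InfinitePlace ℚ,
        galoisCohomology.localization
            ((cofreeTorsionGaloisModule S ρ ((p ^ k : ℕ) : ℤ)).coind (κ.layerSubgroup n) (κ.isOpen_layerSubgroup n)) (Sum.inl w) 1
            (shapiroLift (cofreeTorsionGaloisModule S ρ ((p ^ k : ℕ) : ℤ)).toTopRep (κ.layerSubgroup n) (κ.isOpen_layerSubgroup n)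
              hs hs1 b) = 0) →
      layerLocOf (cofreeTorsionGaloisModule S ρ ((p ^ k : ℕ) : ℤ)) κ v n b = thetaLayerKummer S ρ k W Θ κ v hΘ n Q₀ →
      PadicInt.toZModPow k (z (fun i => ⟨(Q₀ i : localPoints W (v.adicCompletion ℚ)),
        localLayerPointsOfEmb_le_localTowerPointsOfEmb κ _ W n (Q₀ i).2⟩)) = 0) :
    ∃ x : I.H, locd₂ x = z ∧ ∀ n k, N₀ ≤ n →
      (∀ w : HeightOneSpectrum (𝓞 ℚ), w ∉ ((↑S₀ : Set (HeightOneSpectrum (𝓞 ℚ))) ∪ {u | (p : 𝓞 ℚ) ∈ u.asIdeal}) →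
        ∀ 𝔓 ∈ w.primesAbove,
          resLe (cofreeTorsionGaloisModule S ρ ((p ^ k : ℕ) : ℤ)).toTopRep
            (inf_le_left : κ.layerSubgroup n ⊓ 𝔓.inertia (absoluteGaloisGroup ℚ) ≤ κ.layerSubgroup n) 1
            (reduceH1CofreePkTorsion S ρ k (κ.layerSubgroup n) (I.proj n x) :
              H1 (cofreeTorsionGaloisModule S ρ ((p ^ k : ℕ) : ℤ)) (κ.layerSubgroup n)) = 0) ∧
      ∀ w ∈ S₀, ∀ σ : absoluteGaloisGroup ℚ,
        resOfLe ↥(AddSubgroup.torsionBy (Cofree ρ ↥(padicCoeffField S)) ((p ^ k : ℕ) : ℤ))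
            (inf_le_left : κ.layerSubgroup n ⊓ GreenbergSelmer.decomp w ≤ κ.layerSubgroup n)
          (conjH1 (κ.layerSubgroup n) ↥(AddSubgroup.torsionBy (Cofree ρ ↥(padicCoeffField S)) ((p ^ k : ℕ) : ℤ)) σ
            (reduceH1CofreePkTorsion S ρ k (κ.layerSubgroup n) (I.proj n x))) = 0 := by
  haveI : CompactSpace (absoluteGaloisGroup ℚ) := absoluteGaloisGroup_compactSpace ℚ
  haveI : CompactSpace (absoluteGaloisGroup (v.adicCompletion ℚ)) := absoluteGaloisGroup_compactSpace _
  haveI hfi : ∀ n, (κ.layerSubgroup n).FiniteIndex := fun n =>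
    finiteIndex_of_isOpen_of_compactSpace _ (κ.isOpen_layerSubgroup n)
  letI hft : ∀ n, Fintype (absoluteGaloisGroup ℚ ⧸ κ.layerSubgroup n) := fun n => Fintype.ofFinite _
  have hreps : ∀ n, ∃ s : absoluteGaloisGroup ℚ ⧸ κ.layerSubgroup n → absoluteGaloisGroup ℚ,
      (∀ x, (s x : absoluteGaloisGroup ℚ ⧸ κ.layerSubgroup n) = x) ∧ s ((1 : absoluteGaloisGroup ℚ) : _) = 1 :=
    fun n => exists_reps_one _
  choose s hs hs1 using hreps
  have hSfin : ((↑S₀ : Set (HeightOneSpectrum (𝓞 ℚ))) ∪ {u : HeightOneSpectrum (𝓞 ℚ) | (p : 𝓞 ℚ) ∈ u.asIdeal}).Finite := by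
    refine Set.Finite.union S₀.finite_toSet ?_
    have hpne : (p : 𝓞 ℚ) ≠ 0 := by exact_mod_cast (Fact.out : p.Prime).ne_zero
    have hne : Ideal.span {(p : 𝓞 ℚ)} ≠ ⊥ := fun h ↦ hpne (Ideal.span_singleton_eq_bot.mp h)
    refine (Ideal.finite_factors hne).subset fun w hw ↦ ?_
    simp only [Set.mem_setOf_eq] at hw ⊢
    exact Ideal.dvd_iff_le.mpr ((Ideal.span_singleton_le_iff_mem _).mpr hw)
  have hSp : ∀ u : HeightOneSpectrum (𝓞 ℚ), (p : 𝓞 ℚ) ∈ u.asIdeal →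
      u ∈ ((↑S₀ : Set (HeightOneSpectrum (𝓞 ℚ))) ∪ {u : HeightOneSpectrum (𝓞 ℚ) | (p : 𝓞 ℚ) ∈ u.asIdeal}) :=
    fun u hu => Set.mem_union_right _ hu
  -- the solution sets: admissible ∩ strict-at-`S₀` (Shapiro currency) ∩ value condition at `v`
  obtain ⟨x, hxz, hx⟩ := exists_iwasawaH1_locd₂_eq_of_levelwise_from S ρ W ePk hμPk hadd₁Pk hadd₂Pk hgalPk Θ κ v hΘ I pair hpair
    hlocd hκ N₀
    (fun n k => {c : H1 (cofreeTorsionGaloisModule S ρ ((p ^ k : ℕ) : ℤ)) (κ.layerSubgroup n) |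
      (∀ w : HeightOneSpectrum (𝓞 ℚ), w ∉ ((↑S₀ : Set (HeightOneSpectrum (𝓞 ℚ))) ∪ {u | (p : 𝓞 ℚ) ∈ u.asIdeal}) →
        ∀ 𝔓 ∈ w.primesAbove,
          resLe (cofreeTorsionGaloisModule S ρ ((p ^ k : ℕ) : ℤ)).toTopRep
            (inf_le_left : κ.layerSubgroup n ⊓ 𝔓.inertia (absoluteGaloisGroup ℚ) ≤ κ.layerSubgroup n) 1 c = 0) ∧
      (∀ w ∈ S₀,
        galoisCohomology.localization
            ((cofreeTorsionGaloisModule S ρ ((p ^ k : ℕ) : ℤ)).coind (κ.layerSubgroup n) (κ.isOpen_layerSubgroup n)) (Sum.inr w) 1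
            (shapiroLift (cofreeTorsionGaloisModule S ρ ((p ^ k : ℕ) : ℤ)).toTopRep (κ.layerSubgroup n) (κ.isOpen_layerSubgroup n)
              (hs n) (hs1 n) c) = 0) ∧
      ∀ (Q : Fin r → localPoints W (v.adicCompletion ℚ))
        (hQ : ∀ i, Q i ∈ localLayerPointsOfEmb κ (closureEmb (K := ℚ) (v.adicCompletion ℚ)) W n),
        layerPairingH1Of (cofreeTorsionGaloisModule S ρ ((p ^ k : ℕ) : ℤ)) (p ^ k) (ePk k) (hμPk k) (hadd₁Pk k) (hadd₂Pk k)
            (hgalPk k) κ v n (layerLocOf (cofreeTorsionGaloisModule S ρ ((p ^ k : ℕ) : ℤ)) κ v n c)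
            (thetaLayerKummer S ρ k W Θ κ v hΘ n (fun i => ⟨Q i, hQ i⟩)) =
          PadicInt.toZModPow k (z (fun i => ⟨Q i, localLayerPointsOfEmb_le_localTowerPointsOfEmb κ _ W n (hQ i)⟩))})
    (fun n k _ => (admissible_finite_layer S ρ κ k hSfin n).subset fun c hc => hc.1)
    (fun j hj => by
      obtain ⟨c, hadm, hstrict, hval⟩ := exists_admissible_strict_valueCond_of_levelwise_orthogonal_top S ρ W j ePk hμPk hadd₁Pk
        hadd₂Pk hgalPk (hnondeg j) Θ κ v hΘ hκ hv S₀ hS₀ hρ j (hs j) (hs1 j) z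
        (fun b Q₀ => hT j hj j (hs j) (hs1 j) b Q₀)
      exact ⟨c, hadm, hstrict, hval⟩)
    (fun n k _ c hc => ⟨admissible_cofreeTorsionPow S ρ k (κ.layerSubgroup n) hc.1,
      fun w hw => strictAt_cofreeTorsionPow S ρ κ n (hs n) (hs1 n) w k c (hc.2.1 w hw),
      fun Q hQ => valueCond_cohomologyMap_cofreeTorsionPow S ρ W ePk hμPk hadd₁Pk hadd₂Pk hgalPk Θ κ v hΘ htower n k z c hc.2.2 Q hQ⟩)
    (fun n k _ c hc => ⟨admissible_layerCores S ρ _ κ hSp n hc.1,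
      fun w hw => strictAt_layerCores S ρ κ n (hs n) (hs1 n) w (hs (n + 1)) (hs1 (n + 1)) _ c (hc.2.1 w hw),
      fun Q hQ => valueCond_layerCores S ρ W ePk hμPk hadd₁Pk hadd₂Pk hgalPk Θ κ v hΘ hκ hv n k z c hc.2.2 Q hQ⟩)
    z (fun n k _ c hc => hc.2.2)
  refine ⟨x, hxz, fun n k hn => ⟨(hx n k hn).1, fun w hw σ => ?_⟩⟩
  exact ShapiroTransport.resOfLe_decomp_conjH1_eq_zero_of_localization_shapiroLift_eq_zero S ρ _ κ n (hs n) (hs1 n) w _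
    ((hx n k hn).2.1 w hw) σ


include htower hnondeg hκ hv hS₀ hρ hpair hlocd in
/-- **The same assembly with the strictness at `S₀` ALSO in the layer-localisation currency of the AwayTwo pins**: in addition to the
Greenberg–Vatsal reading, `layerLocOf (A_ρ[p^k]) κ w n (red_{p^k}(proj_n x)) = 0` for every `w ∈ S₀`, `n ≥ N₀`, `k` — so every layer pairing of
`red_{p^k}(proj_n x)` at `w` vanishes (`layerPairingOf_apply`), the hypothesis shape of the zero readings `DeepHalfTransfer.locd_eq_zero_of_forall_layer_from`
for the `S₀`-side glue. From the main theorem at `σ = 1` (`conjH1_one_holds`) and the width seat's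
`CofreeSelmerTransfer.layerLocOf_eq_zero_of_resOfLe_decomp_eq_zero` (p694757). CONDITIONAL on `hT`. [cite: Kato2004Asterisque, §12.2 (p. 220), §13.8 (p. 228)]
[cite: Kobayashi2003, (8.23) (p. 18)] [cite: MilneADT2006, Ch. I, Thm. 4.10(b)] -/
theorem exists_iwasawaH1_locd₂_eq_strict_layerLocOf_of_levelwise_orthogonal [CompactSpace ↥(padicCoeffIntegers S)] (N₀ : ℕ)
    (z : (Fin r → localTowerPointsOfEmb κ (closureEmb (K := ℚ) (v.adicCompletion ℚ)) W) →+ ℤ_[p])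
    (hT : ∀ n, N₀ ≤ n → ∀ (k : ℕ) [Fintype (absoluteGaloisGroup ℚ ⧸ κ.layerSubgroup n)]
      {s : absoluteGaloisGroup ℚ ⧸ κ.layerSubgroup n → absoluteGaloisGroup ℚ}
      (hs : ∀ x : absoluteGaloisGroup ℚ ⧸ κ.layerSubgroup n, (s x : absoluteGaloisGroup ℚ ⧸ κ.layerSubgroup n) = x)
      (hs1 : s ((1 : absoluteGaloisGroup ℚ) : absoluteGaloisGroup ℚ ⧸ κ.layerSubgroup n) = 1)
      (b : H1 (cofreeTorsionGaloisModule S ρ ((p ^ k : ℕ) : ℤ)) (κ.layerSubgroup n))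
      (Q₀ : Fin r → localLayerPointsOfEmb κ (closureEmb (K := ℚ) (v.adicCompletion ℚ)) W n),
      (∀ w : HeightOneSpectrum (𝓞 ℚ), w ∉ S₀ → (p : 𝓞 ℚ) ∉ w.asIdeal →
        galoisCohomology.localization
            ((cofreeTorsionGaloisModule S ρ ((p ^ k : ℕ) : ℤ)).coind (κ.layerSubgroup n) (κ.isOpen_layerSubgroup n)) (Sum.inr w) 1
            (shapiroLift (cofreeTorsionGaloisModule S ρ ((p ^ k : ℕ) : ℤ)).toTopRep (κ.layerSubgroup n) (κ.isOpen_layerSubgroup n)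
              hs hs1 b) ∈
          unramifiedSubgroup (GaloisRep.toLocal w
            ((cofreeTorsionGaloisModule S ρ ((p ^ k : ℕ) : ℤ)).coind (κ.layerSubgroup n) (κ.isOpen_layerSubgroup n))) 1) →
      (∀ w : InfinitePlace ℚ,
        galoisCohomology.localization
            ((cofreeTorsionGaloisModule S ρ ((p ^ k : ℕ) : ℤ)).coind (κ.layerSubgroup n) (κ.isOpen_layerSubgroup n)) (Sum.inl w) 1
            (shapiroLift (cofreeTorsionGaloisModule S ρ ((p ^ k : ℕ) : ℤ)).toTopRep (κ.layerSubgroup n) (κ.isOpen_layerSubgroup n)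
              hs hs1 b) = 0) →
      layerLocOf (cofreeTorsionGaloisModule S ρ ((p ^ k : ℕ) : ℤ)) κ v n b = thetaLayerKummer S ρ k W Θ κ v hΘ n Q₀ →
      PadicInt.toZModPow k (z (fun i => ⟨(Q₀ i : localPoints W (v.adicCompletion ℚ)),
        localLayerPointsOfEmb_le_localTowerPointsOfEmb κ _ W n (Q₀ i).2⟩)) = 0) :
    ∃ x : I.H, locd₂ x = z ∧ ∀ n k, N₀ ≤ n →
      (∀ w : HeightOneSpectrum (𝓞 ℚ), w ∉ ((↑S₀ : Set (HeightOneSpectrum (𝓞 ℚ))) ∪ {u | (p : 𝓞 ℚ) ∈ u.asIdeal}) →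
        ∀ 𝔓 ∈ w.primesAbove,
          resLe (cofreeTorsionGaloisModule S ρ ((p ^ k : ℕ) : ℤ)).toTopRep
            (inf_le_left : κ.layerSubgroup n ⊓ 𝔓.inertia (absoluteGaloisGroup ℚ) ≤ κ.layerSubgroup n) 1
            (reduceH1CofreePkTorsion S ρ k (κ.layerSubgroup n) (I.proj n x) :
              H1 (cofreeTorsionGaloisModule S ρ ((p ^ k : ℕ) : ℤ)) (κ.layerSubgroup n)) = 0) ∧
      (∀ w ∈ S₀, ∀ σ : absoluteGaloisGroup ℚ,
        resOfLe ↥(AddSubgroup.torsionBy (Cofree ρ ↥(padicCoeffField S)) ((p ^ k : ℕ) : ℤ))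
            (inf_le_left : κ.layerSubgroup n ⊓ GreenbergSelmer.decomp w ≤ κ.layerSubgroup n)
          (conjH1 (κ.layerSubgroup n) ↥(AddSubgroup.torsionBy (Cofree ρ ↥(padicCoeffField S)) ((p ^ k : ℕ) : ℤ)) σ
            (reduceH1CofreePkTorsion S ρ k (κ.layerSubgroup n) (I.proj n x))) = 0) ∧
      ∀ w ∈ S₀, layerLocOf (cofreeTorsionGaloisModule S ρ ((p ^ k : ℕ) : ℤ)) κ w n
        (reduceH1CofreePkTorsion S ρ k (κ.layerSubgroup n) (I.proj n x) :
          H1 (cofreeTorsionGaloisModule S ρ ((p ^ k : ℕ) : ℤ)) (κ.layerSubgroup n)) = 0 := by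
  obtain ⟨x, hxz, hx⟩ := exists_iwasawaH1_locd₂_eq_strict_of_levelwise_orthogonal S ρ W ePk hμPk hadd₁Pk hadd₂Pk hgalPk htower hnondeg
    Θ κ v hΘ hκ hv S₀ hS₀ hρ I pair hpair hlocd N₀ z hT
  refine ⟨x, hxz, fun n k hn => ⟨(hx n k hn).1, (hx n k hn).2, fun w hw => ?_⟩⟩
  refine CofreeSelmerTransfer.layerLocOf_eq_zero_of_resOfLe_decomp_eq_zero S ρ κ w _ n _ ?_
  have h := (hx n k hn).2 w hw 1
  rwa [Literature.NumberTheory.EllipticCurves.conjH1_one_holds, AddMonoidHom.id_apply] at h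

end Assembly

end ThetaTransport.DeepHalfAssembly

end Summit.BirchSwinnertonDyer.BirchSwinnertonDyer.Theorems

end
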